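import Mathlib
import HarnessLib
import Summits.Ventures.LatticeQCDFlow.Exactness.NCMCGeneralSpaceOccupancyChainDoeblinSweeps

/-!
# The SU(N) `lc_sweep` instance: the NCMC chain with Cabibbo–Marinari sweeps between switches converges from EVERY initial gauge field, with certified error bars

HONEST FRAMING: exact (Metropolis-corrected) sampling algorithms for lattice gauge theory;
figures of merit are autocorrelation/cost numbers at stated couplings and volumes; no
continuum-physics claim.

Venture `LatticeQCDFlow` (cell pub-lqcd), topic `Exactness`; FANOUT row 13 (`eng-snf`, GEN-18).
NEW WORK of the cell, not a published result; no definition is introduced; nothing is cited as a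
fact.  ASSEMBLY of GEN-18's existential two-step certificate
(`…DoeblinMirror.CrooksPair.ncmc_exists_sq_doeblin` ⇒ `…DoeblinHeatBath.CrooksPair.ncmc_everyStart_of_exists_sq`,
`…ncmc_errorBars_of_exists_sq`) with row 9's Cabibbo–Marinari lattice sweep
(`CabibboMarinariLatticeErgodic.lean`: `latSweep_minorised` — the sweep dominates `ε • ⊗Haar` from
every configuration, `ε ≠ 0`), in the setting of GEN-17's
`NCMCGeneralSpaceOccupancyChainSweeps.CrooksPair.ncmc_wilsonCMSweep` (gauge group `SU(N)`, prior /
target `wilsonWeight ρ β₀ / β₁`, Cabibbo–Marinari sweeps as level samplers = `latflow-snf`'s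
`lc_sweep`).  GEN-17: ergodic + consistent from `π_c`.  GEN-18: from EVERY initial state, for every
`c ≠ ΔF` unconditionally (at `c = ΔF`: forward work not almost surely `c`), with the Doeblin-quality
burn-in / variance / `dF_occ`-deviation bounds.

## Content

* `wilson_cmSweep_minorising` — an explicit finite non-zero `ε • ⊗Haar` below every row of the
  Cabibbo–Marinari sweep at `β`, with `wilsonWeight ρ β ≪` it;
* **`CrooksPair.ncmc_wilsonCMSweep_everyStart`** — from EVERY initial state the occupancy fraction
  converges to `σ(c − ΔF)` and `dF_occ,n` to `ΔF` almost surely;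
* **`CrooksPair.ncmc_wilsonCMSweep_errorBars`** — `∃ ε ∈ (0, 1]`: burn-in `|E p̂_n − σ| ≤ 2/(ε n)`
  from any initial law, `Var_π p̂_n ≤ 2(1/2 + (2/ε − 1)/(1 − σ)) σ(1 − σ)/n`,
  `P_π(|dF_occ,n − ΔF| ≥ η) ≤ that/δ_η²`.

NOT CLAIMED: the value of `ε`; anything numerical.
-/

namespace Summit.Ventures.LatticeQCDFlow.Exactness.GeneralNCMC

open MeasureTheory ProbabilityTheory Set Filter Finset
open scoped ENNReal Topology

section CM

open Literature.MathematicalPhysics.QuantumFieldTheory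

variable {n : Type*} [Fintype n] [DecidableEq n] [Nonempty n] [LinearOrder n]
variable {m : Type*} [Fintype m] [DecidableEq m]
variable {d L N : ℕ} (ρ : Matrix.specialUnitaryGroup n ℂ →* Matrix (Fin N) (Fin N) ℂ)

/-- **An explicit minorising measure of the Cabibbo–Marinari sweep, dominating the Wilson weight**:
for `wilsonWeight ρ β` (`ρ` continuous, `L ≠ 0`), frames listing the coordinate pairs
lexicographically (or reversed) and a link list visiting every edge, there is a finite non-zero
measure (`ε • ⊗Haar`) below every row of the sweep, and `wilsonWeight ρ β` is absolutely continuous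
with respect to it. -/
theorem wilson_cmSweep_minorising [NeZero L] (hρ : Continuous ρ) (β : ℝ)
    (frames : List (n ≃ Fin 2 ⊕ m))
    (hlex : frames.map pairOf = lexPairs (Finset.univ.sort (· ≤ ·) : List n) ∨
      frames.map pairOf = (lexPairs (Finset.univ.sort (· ≤ ·) : List n)).reverse)
    {links : List (Edge d L)} (hl : ∀ ed, ed ∈ links) :
    ∃ (mm : Measure (GaugeConfig d L (Matrix.specialUnitaryGroup n ℂ))) (_ : IsFiniteMeasure mm),
      mm univ ≠ 0 ∧
      (∀ z, mm ≤ latSweep (gibbsDensity fun U : GaugeConfig d L (Matrix.specialUnitaryGroup n ℂ) =>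
        β * wilsonAction ρ U) frames links z) ∧
      wilsonWeight (d := d) (L := L) ρ β ≪ mm := by
  have hS : Continuous fun U : GaugeConfig d L (Matrix.specialUnitaryGroup n ℂ) =>
      β * wilsonAction ρ U := continuous_smul_wilsonAction ρ hρ β
  haveI : Nonempty (GaugeConfig d L (Matrix.specialUnitaryGroup n ℂ)) := ⟨fun _ => 1⟩
  obtain ⟨ωa, -, hmin⟩ := isCompact_univ.exists_isMinOn Set.univ_nonempty hS.continuousOn
  obtain ⟨ωb, -, hmax⟩ := isCompact_univ.exists_isMaxOn Set.univ_nonempty hS.continuousOn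
  have hωa : ∀ U, β * wilsonAction ρ ωa ≤ β * wilsonAction ρ U :=
    fun U => (isMinOn_iff.1 hmin) U (Set.mem_univ U)
  have hωb : ∀ U, β * wilsonAction ρ U ≤ β * wilsonAction ρ ωb :=
    fun U => (isMaxOn_iff.1 hmax) U (Set.mem_univ U)
  have hm0 : ENNReal.ofReal (Real.exp (-(β * wilsonAction ρ ωb))) ≠ 0 := by
    rw [ne_eq, ENNReal.ofReal_eq_zero, not_le]; exact Real.exp_pos _
  have hp := measurable_gibbsDensity hS
  have hmp := fun ω => (gibbsDensity_bounds hωa hωb ω).1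
  have hpM := fun ω => (gibbsDensity_bounds hωa hωb ω).2
  obtain ⟨ε, hε, hεmin⟩ := latSweep_minorised hp hm0 ENNReal.ofReal_ne_top hmp hpM frames hlex hl
  haveI := isMarkovKernel_latSweep hp hm0 ENNReal.ofReal_ne_top hmp hpM frames links
  have hε1 : ε ≤ 1 := by
    have h1 := Measure.le_iff'.1 (hεmin 1) Set.univ
    rwa [Measure.smul_apply, smul_eq_mul, measure_univ, measure_univ, mul_one] at h1
  have hmfin : IsFiniteMeasure (ε • Measure.pi (linkHaar (Edge d L) n)) :=
    Measure.smul_finite _ (ne_top_of_le_ne_top ENNReal.one_ne_top hε1)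
  refine ⟨_, hmfin, ?_, hεmin, ?_⟩
  · rw [Measure.smul_apply, smul_eq_mul, measure_univ, mul_one]
    exact hε
  · rw [wilsonWeight_eq_pi_withDensity]
    refine (withDensity_absolutelyContinuous _ _).trans (Measure.AbsolutelyContinuous.mk ?_)
    intro S _ hS
    rw [Measure.smul_apply, smul_eq_mul, mul_eq_zero] at hS
    exact hS.resolve_left hε

/-- **THE SU(N) `lc_sweep` INSTANCE FROM EVERY INITIAL STATE.**  Torus Wilson theory with gauge group
`SU(N)`, continuous `ρ`, `L ≠ 0`; prior `wilsonWeight ρ β₀`, target `wilsonWeight ρ β₁`; level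
samplers = the Cabibbo–Marinari sweeps at `β₀` / `β₁`; ANY Crooks pair between the two weights, ANY
`c` with the forward work not almost surely `c`: from EVERY initial state the occupancy fraction
converges to `σ(c − ΔF)` and `dF_occ,n` to `ΔF` almost surely. -/
theorem CrooksPair.ncmc_wilsonCMSweep_everyStart [NeZero L] (hρ : Continuous ρ) (β₀ β₁ : ℝ)
    (frames₀ frames₁ : List (n ≃ Fin 2 ⊕ m))
    (hlex₀ : frames₀.map pairOf = lexPairs (Finset.univ.sort (· ≤ ·) : List n) ∨
      frames₀.map pairOf = (lexPairs (Finset.univ.sort (· ≤ ·) : List n)).reverse)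
    (hlex₁ : frames₁.map pairOf = lexPairs (Finset.univ.sort (· ≤ ·) : List n) ∨
      frames₁.map pairOf = (lexPairs (Finset.univ.sort (· ≤ ·) : List n)).reverse)
    {links₀ links₁ : List (Edge d L)} (hl₀ : ∀ ed, ed ∈ links₀) (hl₁ : ∀ ed, ed ∈ links₁)
    {E : Type*} [MeasurableSpace E]
    {κF κR : Kernel (GaugeConfig d L (Matrix.specialUnitaryGroup n ℂ)) E} [IsMarkovKernel κF]
    [IsMarkovKernel κR] {s e : E → GaugeConfig d L (Matrix.specialUnitaryGroup n ℂ)} {W : E → ℝ}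
    (h : CrooksPair (wilsonWeight (d := d) (L := L) ρ β₀) (wilsonWeight (d := d) (L := L) ρ β₁)
      κF κR s e W) (c : ℝ)
    (hW : ((wilsonWeight (d := d) (L := L) ρ β₀).bind κF) {ε | W ε ≠ c} ≠ 0) {ΔF : ℝ}
    (hΔF : Real.exp (-ΔF) = (((wilsonWeight (d := d) (L := L) ρ β₀) univ)⁻¹ *
      (wilsonWeight (d := d) (L := L) ρ β₁) univ).toReal) :
    ∃ (_ : IsMarkovKernel (switchKernel κF κR c W s e))
      (_ : IsMarkovKernel (levelKernel
        (latSweep (gibbsDensity fun U : GaugeConfig d L (Matrix.specialUnitaryGroup n ℂ) =>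
          β₀ * wilsonAction ρ U) frames₀ links₀)
        (latSweep (gibbsDensity fun U : GaugeConfig d L (Matrix.specialUnitaryGroup n ℂ) =>
          β₁ * wilsonAction ρ U) frames₁ links₁))),
      ∀ z : Bool × GaugeConfig d L (Matrix.specialUnitaryGroup n ℂ),
        ∀ᵐ x ∂(Kernel.trajMeasure
          (X := fun _ : ℕ => Bool × GaugeConfig d L (Matrix.specialUnitaryGroup n ℂ)) (Measure.dirac z)
          (fun k : ℕ => (switchKernel κF κR c W s e ∘ₖ levelKernel
            (latSweep (gibbsDensity fun U : GaugeConfig d L (Matrix.specialUnitaryGroup n ℂ) =>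
              β₀ * wilsonAction ρ U) frames₀ links₀)
            (latSweep (gibbsDensity fun U : GaugeConfig d L (Matrix.specialUnitaryGroup n ℂ) =>
              β₁ * wilsonAction ρ U) frames₁ links₁)).comap
            (fun hh : (j : ↥(Finset.Iic k)) → Bool × GaugeConfig d L (Matrix.specialUnitaryGroup n ℂ) =>
              hh ⟨k, Finset.mem_Iic.2 le_rfl⟩) (measurable_pi_apply _))),
        Tendsto (fun k : ℕ => (∑ i ∈ range k,
            (targetLevel (GaugeConfig d L (Matrix.specialUnitaryGroup n ℂ))).indicator
              (1 : Bool × GaugeConfig d L (Matrix.specialUnitaryGroup n ℂ) → ℝ) (x i)) / k)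
          atTop (𝓝 (Real.sigmoid (c - ΔF))) ∧
        Tendsto (fun k : ℕ => c - Real.log
            ((∑ i ∈ range k, (targetLevel (GaugeConfig d L (Matrix.specialUnitaryGroup n ℂ))).indicator
                (1 : Bool × GaugeConfig d L (Matrix.specialUnitaryGroup n ℂ) → ℝ) (x i)) / k /
              (1 - (∑ i ∈ range k,
                (targetLevel (GaugeConfig d L (Matrix.specialUnitaryGroup n ℂ))).indicator
                  (1 : Bool × GaugeConfig d L (Matrix.specialUnitaryGroup n ℂ) → ℝ) (x i)) / k)))
          atTop (𝓝 ΔF) := by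
  obtain ⟨hMk₀, hfin₀, -, -, h0, -, hK₀, -⟩ := wilson_cmSweep_package ρ hρ β₀ frames₀ hlex₀ hl₀
  obtain ⟨hMk₁, hfin₁, -, -, h1, -, hK₁, -⟩ := wilson_cmSweep_package ρ hρ β₁ frames₁ hlex₁ hl₁
  obtain ⟨m₀, hmfin₀, hm₀, hmin₀, hac₀⟩ := wilson_cmSweep_minorising ρ hρ β₀ frames₀ hlex₀ hl₀
  obtain ⟨m₁, hmfin₁, hm₁, hmin₁, hac₁⟩ := wilson_cmSweep_minorising ρ hρ β₁ frames₁ hlex₁ hl₁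
  haveI := hMk₀
  haveI := hMk₁
  haveI := hfin₀
  haveI := hfin₁
  haveI := hmfin₀
  haveI := hmfin₁
  refine ⟨isMarkovKernel_switchKernel (κF := κF) (κR := κR) (c := c)
      h.measurable_W h.measurable_s h.measurable_e, isMarkovKernel_levelKernel _ _, fun z => ?_⟩
  exact h.ncmc_everyStart_of_exists_sq h0 h1 hK₀ hK₁
    (h.ncmc_exists_sq_doeblin hm₀ hm₁ hmin₀ hmin₁ hac₀ hac₁ c hW) hΔF z

/-- **CERTIFIED ERROR BARS FOR THE SU(N) `lc_sweep` INSTANCE.**  Same hypotheses: there is an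
`ε ∈ (0, 1]` such that, with `σ = σ(c − ΔF)`: from ANY initial law `|E p̂_n − σ| ≤ 2/(ε n)`; in
equilibrium `Var p̂_n ≤ 2 (1/2 + (2/ε − 1)/(1 − σ)) σ(1 − σ)/n` and
`P(|dF_occ,n − ΔF| ≥ η) ≤ that/δ_η²`, `δ_η = min(σ(c − ΔF + η) − σ, σ − σ(c − ΔF − η))`. -/
theorem CrooksPair.ncmc_wilsonCMSweep_errorBars [NeZero L] (hρ : Continuous ρ) (β₀ β₁ : ℝ)
    (frames₀ frames₁ : List (n ≃ Fin 2 ⊕ m))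
    (hlex₀ : frames₀.map pairOf = lexPairs (Finset.univ.sort (· ≤ ·) : List n) ∨
      frames₀.map pairOf = (lexPairs (Finset.univ.sort (· ≤ ·) : List n)).reverse)
    (hlex₁ : frames₁.map pairOf = lexPairs (Finset.univ.sort (· ≤ ·) : List n) ∨
      frames₁.map pairOf = (lexPairs (Finset.univ.sort (· ≤ ·) : List n)).reverse)
    {links₀ links₁ : List (Edge d L)} (hl₀ : ∀ ed, ed ∈ links₀) (hl₁ : ∀ ed, ed ∈ links₁)
    {E : Type*} [MeasurableSpace E]
    {κF κR : Kernel (GaugeConfig d L (Matrix.specialUnitaryGroup n ℂ)) E} [IsMarkovKernel κF]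
    [IsMarkovKernel κR] {s e : E → GaugeConfig d L (Matrix.specialUnitaryGroup n ℂ)} {W : E → ℝ}
    (h : CrooksPair (wilsonWeight (d := d) (L := L) ρ β₀) (wilsonWeight (d := d) (L := L) ρ β₁)
      κF κR s e W) (c : ℝ)
    (hW : ((wilsonWeight (d := d) (L := L) ρ β₀).bind κF) {ε | W ε ≠ c} ≠ 0) {ΔF : ℝ}
    (hΔF : Real.exp (-ΔF) = (((wilsonWeight (d := d) (L := L) ρ β₀) univ)⁻¹ *
      (wilsonWeight (d := d) (L := L) ρ β₁) univ).toReal) :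
    ∃ (_ : IsMarkovKernel (switchKernel κF κR c W s e))
      (_ : IsMarkovKernel (levelKernel
        (latSweep (gibbsDensity fun U : GaugeConfig d L (Matrix.specialUnitaryGroup n ℂ) =>
          β₀ * wilsonAction ρ U) frames₀ links₀)
        (latSweep (gibbsDensity fun U : GaugeConfig d L (Matrix.specialUnitaryGroup n ℂ) =>
          β₁ * wilsonAction ρ U) frames₁ links₁)))
      (_ : IsFiniteMeasure (wilsonWeight (d := d) (L := L) ρ β₀))
      (_ : IsFiniteMeasure (wilsonWeight (d := d) (L := L) ρ β₁)) (ε : ℝ), 0 < ε ∧ ε ≤ 1 ∧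
      (∀ (μ₀ : Measure (Bool × GaugeConfig d L (Matrix.specialUnitaryGroup n ℂ)))
          [IsProbabilityMeasure μ₀] (k : ℕ), k ≠ 0 →
        |∫ x, (∑ i ∈ range k, (targetLevel (GaugeConfig d L (Matrix.specialUnitaryGroup n ℂ))).indicator
              (1 : Bool × GaugeConfig d L (Matrix.specialUnitaryGroup n ℂ) → ℝ) (x i)) / k
            ∂(Kernel.trajMeasure
              (X := fun _ : ℕ => Bool × GaugeConfig d L (Matrix.specialUnitaryGroup n ℂ)) μ₀
              (fun k : ℕ => (switchKernel κF κR c W s e ∘ₖ levelKernel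
                (latSweep (gibbsDensity fun U : GaugeConfig d L (Matrix.specialUnitaryGroup n ℂ) =>
                  β₀ * wilsonAction ρ U) frames₀ links₀)
                (latSweep (gibbsDensity fun U : GaugeConfig d L (Matrix.specialUnitaryGroup n ℂ) =>
                  β₁ * wilsonAction ρ U) frames₁ links₁)).comap
                (fun hh : (j : ↥(Finset.Iic k)) →
                    Bool × GaugeConfig d L (Matrix.specialUnitaryGroup n ℂ) =>
                  hh ⟨k, Finset.mem_Iic.2 le_rfl⟩) (measurable_pi_apply _))) -
          Real.sigmoid (c - ΔF)| ≤ 2 / (ε * k)) ∧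
      (∀ k : ℕ, k ≠ 0 →
        Var[fun z : ℕ → Bool × GaugeConfig d L (Matrix.specialUnitaryGroup n ℂ) => (∑ i ∈ range k,
            (targetLevel (GaugeConfig d L (Matrix.specialUnitaryGroup n ℂ))).indicator
              (1 : Bool × GaugeConfig d L (Matrix.specialUnitaryGroup n ℂ) → ℝ) (z i)) / k;
          Kernel.trajMeasure (X := fun _ : ℕ => Bool × GaugeConfig d L (Matrix.specialUnitaryGroup n ℂ))
            ((jointWeight c (wilsonWeight (d := d) (L := L) ρ β₀)
              (wilsonWeight (d := d) (L := L) ρ β₁) univ)⁻¹ •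
              jointWeight c (wilsonWeight (d := d) (L := L) ρ β₀) (wilsonWeight (d := d) (L := L) ρ β₁))
            (fun k : ℕ => (switchKernel κF κR c W s e ∘ₖ levelKernel
              (latSweep (gibbsDensity fun U : GaugeConfig d L (Matrix.specialUnitaryGroup n ℂ) =>
                β₀ * wilsonAction ρ U) frames₀ links₀)
              (latSweep (gibbsDensity fun U : GaugeConfig d L (Matrix.specialUnitaryGroup n ℂ) =>
                β₁ * wilsonAction ρ U) frames₁ links₁)).comap
              (fun hh : (j : ↥(Finset.Iic k)) → Bool × GaugeConfig d L (Matrix.specialUnitaryGroup n ℂ) =>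
                hh ⟨k, Finset.mem_Iic.2 le_rfl⟩) (measurable_pi_apply _))] ≤
          2 * (1 / 2 + (2 / ε - 1) / (1 - Real.sigmoid (c - ΔF))) *
            (Real.sigmoid (c - ΔF) * (1 - Real.sigmoid (c - ΔF))) / k) ∧
      (∀ k : ℕ, k ≠ 0 → ∀ η : ℝ, 0 < η →
        Kernel.trajMeasure (X := fun _ : ℕ => Bool × GaugeConfig d L (Matrix.specialUnitaryGroup n ℂ))
            ((jointWeight c (wilsonWeight (d := d) (L := L) ρ β₀)
              (wilsonWeight (d := d) (L := L) ρ β₁) univ)⁻¹ •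
              jointWeight c (wilsonWeight (d := d) (L := L) ρ β₀) (wilsonWeight (d := d) (L := L) ρ β₁))
            (fun k : ℕ => (switchKernel κF κR c W s e ∘ₖ levelKernel
              (latSweep (gibbsDensity fun U : GaugeConfig d L (Matrix.specialUnitaryGroup n ℂ) =>
                β₀ * wilsonAction ρ U) frames₀ links₀)
              (latSweep (gibbsDensity fun U : GaugeConfig d L (Matrix.specialUnitaryGroup n ℂ) =>
                β₁ * wilsonAction ρ U) frames₁ links₁)).comap
              (fun hh : (j : ↥(Finset.Iic k)) → Bool × GaugeConfig d L (Matrix.specialUnitaryGroup n ℂ) =>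
                hh ⟨k, Finset.mem_Iic.2 le_rfl⟩) (measurable_pi_apply _))
          {z | η ≤ |c - Real.log
              ((∑ i ∈ range k, (targetLevel (GaugeConfig d L (Matrix.specialUnitaryGroup n ℂ))).indicator
                  (1 : Bool × GaugeConfig d L (Matrix.specialUnitaryGroup n ℂ) → ℝ) (z i)) / k /
                (1 - (∑ i ∈ range k,
                  (targetLevel (GaugeConfig d L (Matrix.specialUnitaryGroup n ℂ))).indicator
                    (1 : Bool × GaugeConfig d L (Matrix.specialUnitaryGroup n ℂ) → ℝ) (z i)) / k)) -
              ΔF|} ≤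
          ENNReal.ofReal (2 * (1 / 2 + (2 / ε - 1) / (1 - Real.sigmoid (c - ΔF))) *
            (Real.sigmoid (c - ΔF) * (1 - Real.sigmoid (c - ΔF))) / k /
            (min (Real.sigmoid (c - ΔF + η) - Real.sigmoid (c - ΔF))
              (Real.sigmoid (c - ΔF) - Real.sigmoid (c - ΔF - η))) ^ 2)) := by
  obtain ⟨hMk₀, hfin₀, -, -, h0, -, hK₀, -⟩ := wilson_cmSweep_package ρ hρ β₀ frames₀ hlex₀ hl₀
  obtain ⟨hMk₁, hfin₁, -, -, h1, -, hK₁, -⟩ := wilson_cmSweep_package ρ hρ β₁ frames₁ hlex₁ hl₁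
  obtain ⟨m₀, hmfin₀, hm₀, hmin₀, hac₀⟩ := wilson_cmSweep_minorising ρ hρ β₀ frames₀ hlex₀ hl₀
  obtain ⟨m₁, hmfin₁, hm₁, hmin₁, hac₁⟩ := wilson_cmSweep_minorising ρ hρ β₁ frames₁ hlex₁ hl₁
  haveI := hMk₀
  haveI := hMk₁
  haveI := hfin₀
  haveI := hfin₁
  haveI := hmfin₀
  haveI := hmfin₁
  obtain ⟨ε, hε0, hε1, hA, hB, hC⟩ := h.ncmc_errorBars_of_exists_sq h0 h1 hK₀ hK₁
    (h.ncmc_exists_sq_doeblin hm₀ hm₁ hmin₀ hmin₁ hac₀ hac₁ c hW) hΔF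
  exact ⟨isMarkovKernel_switchKernel (κF := κF) (κR := κR) (c := c)
      h.measurable_W h.measurable_s h.measurable_e, isMarkovKernel_levelKernel _ _, hfin₀, hfin₁,
    ε, hε0, hε1, hA, hB, hC⟩

end CM

end Summit.Ventures.LatticeQCDFlow.Exactness.GeneralNCMC
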